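import Summits.ABC.ABC.Theorems.TwistAmplificationSharpModerateLawDefs

/-!
# Crux `SharpModerateLaw` (stmt-ABC-1975), line `syzygy-lattice-half-deep-few-primes`: `stub_syzygyTransfer`

`IndexFormShellLaw → CuspShellLaw` by the Delone–Faddeev / Cayley-syzygy dictionary.  For `x = (c₄, c₆)`,
`c₄³ ≠ c₆²`, put `F₀ = (1, 0, −3c₄, −2c₆)` (`R(F₀) = ℤ[ω₀]`, `ω₀³ − 3c₄ω₀ + 2c₆ = 0`); embed `R(F₀)` in a maximal
cubic ring (`RingOfForm.exists_isMaximal_overring`), move to the orbit representative `F = orbitRep O`, write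
`ω₀ ↦ η = t₀ + uω + vθ`: Cayley–Hamilton for `ξ = uω + vθ` and the transported relation are two monic cubics
killing `η`, their difference pulls back to a `ℤ`-relation between `1, ω₀, ω₀²`, hence vanishes, so
`H_F(u,v) = 9c₄`, `G_F(u,v) = −54c₆`, `D·F(u,v)² = 108(c₄³ − c₆²)` (`exists_indexFormData`).  Hence
`Mplus F q = 186624·Mcusp x` (`186624 = 108·1728 = 256·9³`), `N5 F q = N5cusp x`, `ContentOK q`, and
`x ↦ (D, O, q)` is injective: `#cuspShell X Y ≤ totalCount ⊤ X (186624·Y)` (`ncard_cuspShell_le`; shells of a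
nondegenerate form are finite by `Res(F, H_F) = D²`, `finite_mplus_le`); finally `(186624·Y)^{-1/6} ≤ Y^{-1/6}`.
-/

noncomputable section

namespace Summit.ABC.ABC.Theorems.SharpModerateLaw

open Literature.NumberTheory.CubicFields BinaryCubic

/-- Cayley–Hamilton for `ξ_{u,v} = u·ω + v·θ = (0, u, v)` in `R(F)`: `ξ³ − s₁ξ² + s₂ξ − s₃ = 0` with the explicit
trace `s₁ = bu − cv`, second coefficient `s₂` and norm `s₃` (adapted from the v2 skeleton, kernel-checked there). -/
private theorem xi_charpoly (F : BinaryCubic ℤ) (u v : ℤ) :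
    (⟨0, u, v⟩ : RingOfForm F) * ⟨0, u, v⟩ * ⟨0, u, v⟩ - ((F.b * u - F.c * v : ℤ) : RingOfForm F) * (⟨0, u, v⟩ * ⟨0, u, v⟩)
      + ((F.a * F.c * u ^ 2 + (3 * F.a * F.d - F.b * F.c) * u * v + F.b * F.d * v ^ 2 : ℤ) : RingOfForm F) * ⟨0, u, v⟩
      - ((F.a ^ 2 * F.d * u ^ 3 + (2 * F.a * F.b * F.d - F.a * F.c ^ 2) * u ^ 2 * v
          + (F.b ^ 2 * F.d - 2 * F.a * F.c * F.d) * u * v ^ 2 - F.a * F.d ^ 2 * v ^ 3 : ℤ) : RingOfForm F) = 0 := by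
  ext <;> simp only [RingOfForm.sub_x, RingOfForm.sub_y, RingOfForm.sub_z, RingOfForm.add_x, RingOfForm.add_y,
      RingOfForm.add_z, RingOfForm.mul_x, RingOfForm.mul_y, RingOfForm.mul_z, RingOfForm.intCast_x, RingOfForm.intCast_y,
      RingOfForm.intCast_z, RingOfForm.zero_x, RingOfForm.zero_y, RingOfForm.zero_z] <;> ring

/-- `D²·u⁴, D²·v⁴ ∈ (F, H_F)`: the Sylvester cofactors of the resultant `Res(F, H_F) = Disc(F)²`. -/
private theorem bezout (F : BinaryCubic ℤ) : ∃ α β γ δ ε α' β' γ' δ' ε' : ℤ, ∀ u v : ℤ,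
    (α * u + β * v) * F.eval u v + (γ * u ^ 2 + δ * u * v + ε * v ^ 2) * hessAt F u v = F.disc ^ 2 * u ^ 4 ∧
    (α' * u + β' * v) * F.eval u v + (γ' * u ^ 2 + δ' * u * v + ε' * v ^ 2) * hessAt F u v = F.disc ^ 2 * v ^ 4 :=
  ⟨729 * F.a ^ 3 * F.d ^ 4 - 648 * F.a ^ 2 * F.b * F.c * F.d ^ 3 + 135 * F.a ^ 2 * F.c ^ 3 * F.d ^ 2 + 108 * F.a * F.b ^ 3 * F.d ^ 3
      + 81 * F.a * F.b ^ 2 * F.c ^ 2 * F.d ^ 2 - 42 * F.a * F.b * F.c ^ 4 * F.d + 4 * F.a * F.c ^ 6 - 24 * F.b ^ 4 * F.c * F.d ^ 2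
      + 10 * F.b ^ 3 * F.c ^ 3 * F.d - F.b ^ 2 * F.c ^ 5,
    243 * F.a ^ 2 * F.b * F.d ^ 4 - 81 * F.a ^ 2 * F.c ^ 2 * F.d ^ 3 - 162 * F.a * F.b ^ 2 * F.c * F.d ^ 3 + 90 * F.a * F.b * F.c ^ 3 * F.d ^ 2
      - 12 * F.a * F.c ^ 5 * F.d + 36 * F.b ^ 4 * F.d ^ 3 - 21 * F.b ^ 3 * F.c ^ 2 * F.d ^ 2 + 3 * F.b ^ 2 * F.c ^ 4 * F.d,
    108 * F.a ^ 2 * F.b * F.d ^ 3 - 27 * F.a ^ 2 * F.c ^ 2 * F.d ^ 2 - 72 * F.a * F.b ^ 2 * F.c * F.d ^ 2 + 34 * F.a * F.b * F.c ^ 3 * F.d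
      - 4 * F.a * F.c ^ 5 + 16 * F.b ^ 4 * F.d ^ 2 - 8 * F.b ^ 3 * F.c ^ 2 * F.d + F.b ^ 2 * F.c ^ 4,
    54 * F.a ^ 2 * F.c * F.d ^ 3 - 36 * F.a * F.b * F.c ^ 2 * F.d ^ 2 + 8 * F.a * F.c ^ 4 * F.d + 8 * F.b ^ 3 * F.c * F.d ^ 2
      - 2 * F.b ^ 2 * F.c ^ 3 * F.d,
    81 * F.a ^ 2 * F.d ^ 4 - 54 * F.a * F.b * F.c * F.d ^ 3 + 12 * F.a * F.c ^ 3 * F.d ^ 2 + 12 * F.b ^ 3 * F.d ^ 3 - 3 * F.b ^ 2 * F.c ^ 2 * F.d ^ 2,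
    243 * F.a ^ 4 * F.c * F.d ^ 2 - 81 * F.a ^ 3 * F.b ^ 2 * F.d ^ 2 - 162 * F.a ^ 3 * F.b * F.c ^ 2 * F.d + 36 * F.a ^ 3 * F.c ^ 4
      + 90 * F.a ^ 2 * F.b ^ 3 * F.c * F.d - 21 * F.a ^ 2 * F.b ^ 2 * F.c ^ 3 - 12 * F.a * F.b ^ 5 * F.d + 3 * F.a * F.b ^ 4 * F.c ^ 2,
    729 * F.a ^ 4 * F.d ^ 3 - 648 * F.a ^ 3 * F.b * F.c * F.d ^ 2 + 108 * F.a ^ 3 * F.c ^ 3 * F.d + 135 * F.a ^ 2 * F.b ^ 3 * F.d ^ 2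
      + 81 * F.a ^ 2 * F.b ^ 2 * F.c ^ 2 * F.d - 24 * F.a ^ 2 * F.b * F.c ^ 4 - 42 * F.a * F.b ^ 4 * F.c * F.d
      + 10 * F.a * F.b ^ 3 * F.c ^ 3 + 4 * F.b ^ 6 * F.d - F.b ^ 5 * F.c ^ 2,
    81 * F.a ^ 4 * F.d ^ 2 - 54 * F.a ^ 3 * F.b * F.c * F.d + 12 * F.a ^ 3 * F.c ^ 3 + 12 * F.a ^ 2 * F.b ^ 3 * F.d - 3 * F.a ^ 2 * F.b ^ 2 * F.c ^ 2,
    54 * F.a ^ 3 * F.b * F.d ^ 2 - 36 * F.a ^ 2 * F.b ^ 2 * F.c * F.d + 8 * F.a ^ 2 * F.b * F.c ^ 3 + 8 * F.a * F.b ^ 4 * F.d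
      - 2 * F.a * F.b ^ 3 * F.c ^ 2,
    108 * F.a ^ 3 * F.c * F.d ^ 2 - 27 * F.a ^ 2 * F.b ^ 2 * F.d ^ 2 - 72 * F.a ^ 2 * F.b * F.c ^ 2 * F.d + 16 * F.a ^ 2 * F.c ^ 4
      + 34 * F.a * F.b ^ 3 * F.c * F.d - 8 * F.a * F.b ^ 2 * F.c ^ 3 - 4 * F.b ^ 5 * F.d + F.b ^ 4 * F.c ^ 2,
    fun u v => ⟨by simp only [hessAt, BinaryCubic.eval, BinaryCubic.disc_eq]; ring,
      by simp only [hessAt, BinaryCubic.eval, BinaryCubic.disc_eq]; ring⟩⟩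

/-- From `(αu + βv)f + (γu² + δuv + εv²)h = D²·w⁴`, `D ≠ 0`, `|u|, |v| ≤ m`, `1 ≤ m`, `|f|, |h| ≤ B`:
`|w|⁴ ≤ (|α| + |β| + |γ| + |δ| + |ε|)·m²·B`. -/
private theorem pow_four_le {α β γ δ ε u v f h m B D w : ℤ} (hD : D ≠ 0)
    (hid : (α * u + β * v) * f + (γ * u ^ 2 + δ * u * v + ε * v ^ 2) * h = D ^ 2 * w ^ 4)
    (hu : |u| ≤ m) (hv : |v| ≤ m) (h1 : 1 ≤ m) (hf : |f| ≤ B) (hh : |h| ≤ B) :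
    |w| ^ 4 ≤ (|α| + |β| + |γ| + |δ| + |ε|) * m ^ 2 * B := by
  have hm2 : m ≤ m ^ 2 := by nlinarith
  have key : ∀ (k : ℤ) {s t S T : ℤ}, s ≤ S → t ≤ T → 0 ≤ s → 0 ≤ t → |k| * s * t ≤ |k| * S * T :=
    fun k s t S T hs ht hs0 ht0 => by
      rw [mul_assoc, mul_assoc]; exact mul_le_mul_of_nonneg_left (mul_le_mul hs ht ht0 (hs0.trans hs)) (abs_nonneg _)
  have t1 := key α (hu.trans hm2) hf (abs_nonneg u) (abs_nonneg f)
  have t2 := key β (hv.trans hm2) hf (abs_nonneg v) (abs_nonneg f)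
  have t3 := key γ (show |u| * |u| ≤ m ^ 2 by nlinarith [abs_nonneg u]) hh (by positivity) (abs_nonneg h)
  have t4 := key δ (show |u| * |v| ≤ m ^ 2 by nlinarith [abs_nonneg u, abs_nonneg v]) hh (by positivity) (abs_nonneg h)
  have t5 := key ε (show |v| * |v| ≤ m ^ 2 by nlinarith [abs_nonneg v]) hh (by positivity) (abs_nonneg h)
  have s1 := abs_add_le (α * u * f + β * v * f + γ * (u * u) * h + δ * (u * v) * h) (ε * (v * v) * h)
  have s2 := abs_add_le (α * u * f + β * v * f + γ * (u * u) * h) (δ * (u * v) * h)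
  have s3 := abs_add_le (α * u * f + β * v * f) (γ * (u * u) * h)
  have s4 := abs_add_le (α * u * f) (β * v * f)
  have e : |w| ^ 4 ≤ |α * u * f + β * v * f + γ * (u * u) * h + δ * (u * v) * h + ε * (v * v) * h| := by
    rw [show α * u * f + β * v * f + γ * (u * u) * h + δ * (u * v) * h + ε * (v * v) * h = D ^ 2 * w ^ 4 by
      rw [← hid]; ring, abs_mul, abs_pow, abs_pow]
    exact le_mul_of_one_le_left (by positivity) (one_le_pow₀ (Int.one_le_abs hD))
  simp only [abs_mul] at s1 s2 s3 s4 t1 t2 t3 t4 t5 e ⊢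
  nlinarith [s1, s2, s3, s4, t1, t2, t3, t4, t5, e]

/-- **Shells of a nondegenerate form are finite**: bounded `|F(q)|, |H_F(q)|` bound `|q|` via `D²u⁴, D²v⁴ ∈ (F, H_F)`. -/
theorem finite_mplus_le (F : BinaryCubic ℤ) (hF : F.disc ≠ 0) (B : ℕ) : {q : ℤ × ℤ | Mplus F q ≤ B}.Finite := by
  obtain ⟨α, β, γ, δ, ε, α', β', γ', δ', ε', hUV⟩ := bezout F
  set K : ℤ := (|α| + |β| + |γ| + |δ| + |ε|) + (|α'| + |β'| + |γ'| + |δ'| + |ε'|) with hK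
  refine ((Set.finite_Icc (-(K * B)) (K * B)).prod (Set.finite_Icc (-(K * B)) (K * B))).subset ?_
  rintro ⟨u, v⟩ hq
  simp only [Set.mem_setOf_eq, Mplus] at hq
  have hf : |F.eval u v| ≤ B := by
    have h1 : ((F.disc * F.eval u v ^ 2).natAbs : ℤ) ≤ B := by exact_mod_cast (le_max_left _ _).trans hq
    rw [Int.natCast_natAbs, abs_mul, abs_pow] at h1
    have h3 : |F.eval u v| ^ 2 ≤ |F.disc| * |F.eval u v| ^ 2 := le_mul_of_one_le_left (sq_nonneg _) (Int.one_le_abs hF)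
    linarith [Int.le_self_sq (|F.eval u v|)]
  have hh : |hessAt F u v| ≤ B := by
    have h1 : ((256 * (hessAt F u v).natAbs ^ 3 : ℕ) : ℤ) ≤ B := by exact_mod_cast (le_max_right _ _).trans hq
    push_cast at h1
    rcases (abs_nonneg (hessAt F u v)).eq_or_lt with h0 | h0
    · rw [← h0]; positivity
    · linarith [le_self_pow₀ (show (1 : ℤ) ≤ |hessAt F u v| from h0) (by norm_num : (3 : ℕ) ≠ 0),
        pow_nonneg (abs_nonneg (hessAt F u v)) 3]
  set m : ℤ := max |u| |v| with hm
  have hum : |u| ≤ m := le_max_left _ _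
  have hvm : |v| ≤ m := le_max_right _ _
  have hmKB : m ≤ K * B := by
    rcases ((abs_nonneg u).trans hum).eq_or_lt with h0 | h0
    · rw [← h0]; positivity
    have h1m : (1 : ℤ) ≤ m := h0
    have hB0 : (0 : ℤ) ≤ B := (abs_nonneg _).trans hf
    have hu4 := pow_four_le hF (hUV u v).1 hum hvm h1m hf hh
    have hv4 := pow_four_le hF (hUV u v).2 hum hvm h1m hf hh
    have hm4 : m ^ 4 ≤ K * m ^ 2 * B := by
      have p1 : 0 ≤ (|α| + |β| + |γ| + |δ| + |ε|) * m ^ 2 * B := by positivity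
      have p2 : 0 ≤ (|α'| + |β'| + |γ'| + |δ'| + |ε'|) * m ^ 2 * B := by positivity
      rcases max_choice |u| |v| with h | h
      · rw [hm, h] at hu4 p1 p2 ⊢; linarith
      · rw [hm, h] at hv4 p1 p2 ⊢; linarith
    have hm2 : m ^ 2 ≤ K * B := le_of_mul_le_mul_right (by nlinarith : m ^ 2 * m ^ 2 ≤ K * B * m ^ 2) (by positivity)
    nlinarith
  exact ⟨Set.mem_Icc.mpr (abs_le.mp (hum.trans hmKB)), Set.mem_Icc.mpr (abs_le.mp (hvm.trans hmKB))⟩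

/-- **The dictionary step.** For `c₄³ ≠ c₆²` there are a MAXIMAL orbit representative `F = orbitRep O` and
`q = (u, v)` with `H_F(q) = 9c₄`, `G_F(q) = −54c₆`, `D·F(q)² = 108(c₄³ − c₆²)` (module docstring; the hypothesis
`c₄³ ≠ c₆²` sits inside so that a total choice function exists). -/
theorem exists_indexFormData (x : ℤ × ℤ) :
    ∃ D : ℤ, ∃ O : orbitsOfDisc D, ∃ q : ℤ × ℤ, x.1 ^ 3 ≠ x.2 ^ 2 → RingOfForm.IsMaximal (orbitRep O) ∧
      hessAt (orbitRep O) q.1 q.2 = 9 * x.1 ∧ covAt (orbitRep O) q.1 q.2 = -54 * x.2 ∧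
      (orbitRep O).disc * (orbitRep O).eval q.1 q.2 ^ 2 = 108 * (x.1 ^ 3 - x.2 ^ 2) := by
  by_cases hx : x.1 ^ 3 = x.2 ^ 2
  · exact ⟨_, ⟨gl2zOrbit ⟨1, 0, 0, 0⟩, _, rfl, rfl⟩, (0, 0), fun h => absurd hx h⟩
  have hD₀ : (⟨1, 0, -3 * x.1, -2 * x.2⟩ : BinaryCubic ℤ).disc ≠ 0 := by
    rw [(normalForm_invariants x.1 x.2).2.2]; exact mul_ne_zero (by norm_num) (sub_ne_zero.mpr hx)
  have hrel₀ : RingOfForm.omega (⟨1, 0, -3 * x.1, -2 * x.2⟩ : BinaryCubic ℤ) * RingOfForm.omega _ * RingOfForm.omega _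
      - ((3 * x.1 : ℤ) : RingOfForm _) * RingOfForm.omega _ + ((2 * x.2 : ℤ) : RingOfForm _) = 0 := by
    ext <;> simp [-Int.cast_mul, -Int.cast_ofNat]
  have hcoords : ∀ p q r : ℤ, -(p : RingOfForm (⟨1, 0, -3 * x.1, -2 * x.2⟩ : BinaryCubic ℤ)) *
      (RingOfForm.omega _ * RingOfForm.omega _) + (q : RingOfForm _) * RingOfForm.omega _ - (r : RingOfForm _)
        = ⟨-(3 * x.1 * p) - r, q, p⟩ := fun p q r => by
    ext <;> simp
    ring
  obtain ⟨G, hGmax, φ, hφ⟩ := RingOfForm.exists_isMaximal_overring hD₀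
  let O : orbitsOfDisc G.disc := ⟨gl2zOrbit G, G, rfl, rfl⟩
  have hGF : GL2ZEquiv G (orbitRep O) := gl2zEquiv_orbitRep G
  obtain ⟨e⟩ := RingOfForm.nonempty_ringEquiv_of_gl2zEquiv hGF
  let ψ : RingOfForm ⟨1, 0, -3 * x.1, -2 * x.2⟩ →+* RingOfForm (orbitRep O) := e.symm.toRingHom.comp φ
  have hψ : Function.Injective ψ := e.symm.injective.comp hφ
  obtain ⟨⟨t₀, u, v⟩, hη⟩ : ∃ p : RingOfForm (orbitRep O), ψ (RingOfForm.omega _) = p := ⟨_, rfl⟩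
  have hlit : (⟨t₀, u, v⟩ : RingOfForm (orbitRep O)) = (t₀ : RingOfForm _) + ⟨0, u, v⟩ := by ext <;> simp
  rw [hlit] at hη
  refine ⟨G.disc, O, (u, v), fun _ => ⟨hGmax.of_gl2zEquiv hGF, ?_⟩⟩
  have hCH₀ := xi_charpoly (orbitRep O) u v
  set η : RingOfForm (orbitRep O) := (t₀ : RingOfForm _) + ⟨0, u, v⟩ with hηdef
  set s₁ : ℤ := (orbitRep O).b * u - (orbitRep O).c * v with hs₁d
  set s₂ : ℤ := (orbitRep O).a * (orbitRep O).c * u ^ 2 + (3 * (orbitRep O).a * (orbitRep O).d - (orbitRep O).b * (orbitRep O).c) * u * v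
    + (orbitRep O).b * (orbitRep O).d * v ^ 2 with hs₂d
  set s₃ : ℤ := (orbitRep O).a ^ 2 * (orbitRep O).d * u ^ 3
    + (2 * (orbitRep O).a * (orbitRep O).b * (orbitRep O).d - (orbitRep O).a * (orbitRep O).c ^ 2) * u ^ 2 * v
    + ((orbitRep O).b ^ 2 * (orbitRep O).d - 2 * (orbitRep O).a * (orbitRep O).c * (orbitRep O).d) * u * v ^ 2
    - (orbitRep O).a * (orbitRep O).d ^ 2 * v ^ 3 with hs₃d
  -- the dictionary: translation-invariant combinations of the characteristic coefficients
  have dH : s₁ ^ 2 - 3 * s₂ = hessAt (orbitRep O) u v := by rw [hs₁d, hs₂d]; simp only [hessAt]; ring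
  have dG : 2 * s₁ ^ 3 - 9 * s₁ * s₂ + 27 * s₃ = covAt (orbitRep O) u v := by rw [hs₁d, hs₂d, hs₃d]; simp only [covAt]; ring
  have dD : s₁ ^ 2 * s₂ ^ 2 - 4 * s₂ ^ 3 - 4 * s₁ ^ 3 * s₃ + 18 * s₁ * s₂ * s₃ - 27 * s₃ ^ 2
      = (orbitRep O).disc * (orbitRep O).eval u v ^ 2 := by
    rw [hs₁d, hs₂d, hs₃d]; simp only [BinaryCubic.disc_eq, BinaryCubic.eval]; ring
  have hrel : η * η * η - ((3 * x.1 : ℤ) : RingOfForm (orbitRep O)) * η + ((2 * x.2 : ℤ) : RingOfForm (orbitRep O)) = 0 := by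
    simpa only [map_sub, map_add, map_mul, map_intCast, map_zero, hη] using congrArg ψ hrel₀
  have hCH : η * η * η - ((s₁ + 3 * t₀ : ℤ) : RingOfForm (orbitRep O)) * (η * η)
      + ((s₂ + 2 * s₁ * t₀ + 3 * t₀ ^ 2 : ℤ) : RingOfForm (orbitRep O)) * η
      - ((s₃ + s₂ * t₀ + s₁ * t₀ ^ 2 + t₀ ^ 3 : ℤ) : RingOfForm (orbitRep O)) = 0 := by
    rw [hηdef]; push_cast at hCH₀ ⊢; linear_combination hCH₀
  have hZ₀ : -((s₁ + 3 * t₀ : ℤ) : RingOfForm (⟨1, 0, -3 * x.1, -2 * x.2⟩ : BinaryCubic ℤ)) * (RingOfForm.omega _ * RingOfForm.omega _)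
      + ((s₂ + 2 * s₁ * t₀ + 3 * t₀ ^ 2 + 3 * x.1 : ℤ) : RingOfForm _) * RingOfForm.omega _
      - ((s₃ + s₂ * t₀ + s₁ * t₀ ^ 2 + t₀ ^ 3 + 2 * x.2 : ℤ) : RingOfForm _) = 0 := by
    apply hψ
    rw [map_zero]; simp only [map_sub, map_add, map_mul, map_neg, map_intCast, hη]
    push_cast at hCH hrel ⊢
    linear_combination hCH - hrel
  rw [hcoords] at hZ₀
  obtain ⟨h0x, h0y, h0z⟩ := RingOfForm.ext_iff.mp hZ₀
  simp only [RingOfForm.zero_x, RingOfForm.zero_y, RingOfForm.zero_z] at h0x h0y h0z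
  have hs₁ : s₁ = -3 * t₀ := by linarith
  have hs₂ : s₂ = 3 * t₀ ^ 2 - 3 * x.1 := by rw [hs₁] at h0y; linarith
  have hs₃ : s₃ = -t₀ ^ 3 + 3 * x.1 * t₀ - 2 * x.2 := by rw [hs₁, hs₂] at h0x; linear_combination -h0x
  refine ⟨?_, ?_, ?_⟩
  · show hessAt (orbitRep O) u v = 9 * x.1
    rw [← dH, hs₁, hs₂]; ring
  · show covAt (orbitRep O) u v = -54 * x.2
    rw [← dG, hs₁, hs₂, hs₃]; ring
  · show (orbitRep O).disc * (orbitRep O).eval u v ^ 2 = 108 * (x.1 ^ 3 - x.2 ^ 2)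
    rw [← dD, hs₁, hs₂, hs₃]; ring

/-- Tower-freeness of `(c₄, c₆)` gives `ContentOK` (`g = gcd(u,v)`: `g² ∣ H_F(q) = 9c₄`, `g³ ∣ G_F(q) = −54c₆`). -/
theorem contentOK_of_data {x : ℤ × ℤ} (hTF : TF x) {F : BinaryCubic ℤ} {q : ℤ × ℤ}
    (hH : hessAt F q.1 q.2 = 9 * x.1) (hG : covAt F q.1 q.2 = -54 * x.2) : ContentOK q := by
  obtain ⟨hTF5, hTF2, hTF3⟩ := hTF
  obtain ⟨u', hu'⟩ := Int.gcd_dvd_left q.1 q.2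
  obtain ⟨v', hv'⟩ := Int.gcd_dvd_right q.1 q.2
  set g : ℕ := Int.gcd q.1 q.2 with hg
  have h2 : g ^ 2 ∣ 9 * x.1.natAbs := by
    have h : ((g : ℤ)) ^ 2 ∣ 9 * x.1 := ⟨hessAt F u' v', by rw [← hH, hu', hv']; simp only [hessAt]; ring⟩
    simpa [Int.natAbs_mul, Int.natAbs_pow] using Int.natAbs_dvd_natAbs.mpr h
  have h3 : g ^ 3 ∣ 54 * x.2.natAbs := by
    have e : covAt F q.1 q.2 = (g : ℤ) ^ 3 * covAt F u' v' := by rw [hu', hv']; simp only [covAt]; ring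
    have h : ((g : ℤ)) ^ 3 ∣ 54 * x.2 := ⟨-covAt F u' v', by linear_combination hG - e⟩
    simpa [Int.natAbs_mul, Int.natAbs_pow] using Int.natAbs_dvd_natAbs.mpr h
  have pw2 : ∀ {n : ℕ}, n ∣ g → n ^ 2 ∣ 9 * x.1.natAbs := fun h => (pow_dvd_pow_of_dvd h 2).trans h2
  have pw3 : ∀ {n : ℕ}, n ∣ g → n ^ 3 ∣ 54 * x.2.natAbs := fun h => (pow_dvd_pow_of_dvd h 3).trans h3
  refine ⟨fun p hp hp5 hpg => hTF5 p hp hp5 ?_, fun h2g => hTF2 ⟨?_, ?_⟩, fun h3g => hTF3 ⟨?_, ?_⟩⟩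
  · have hp3 : Nat.Coprime p 3 := (Nat.coprime_primes hp Nat.prime_three).mpr (by omega)
    have hp2 : Nat.Coprime p 2 := (Nat.coprime_primes hp Nat.prime_two).mpr (by omega)
    have hc9 : Nat.Coprime (p ^ 4) 9 := by simpa using Nat.Coprime.pow 4 2 hp3
    have hc54 : Nat.Coprime (p ^ 6) 54 := by simpa using Nat.Coprime.mul_right (Nat.Coprime.pow 6 1 hp2) (Nat.Coprime.pow 6 3 hp3)
    have h4 : p ^ 4 ∣ 9 * x.1.natAbs := by simpa [← pow_mul] using pw2 hpg
    have h6 : p ^ 6 ∣ 54 * x.2.natAbs := by simpa [← pow_mul] using pw3 hpg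
    exact ⟨by exact_mod_cast Int.ofNat_dvd_left.mpr (hc9.dvd_of_dvd_mul_left h4),
      by exact_mod_cast Int.ofNat_dvd_left.mpr (hc54.dvd_of_dvd_mul_left h6)⟩
  · have h : 2 ^ 8 ∣ 9 * x.1.natAbs := by simpa using pw2 h2g
    exact_mod_cast Int.ofNat_dvd_left.mpr ((by decide : Nat.Coprime (2 ^ 8) 9).dvd_of_dvd_mul_left h)
  · have h : 2 ^ 12 ∣ 54 * x.2.natAbs := by simpa using pw3 h2g
    have h' : 2 ^ 11 ∣ 27 * x.2.natAbs := Nat.dvd_of_mul_dvd_mul_left (k := 2) (by norm_num) (by convert h using 1 <;> ring)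
    exact_mod_cast Int.ofNat_dvd_left.mpr ((by decide : Nat.Coprime (2 ^ 11) 27).dvd_of_dvd_mul_left h')
  · have h : 3 ^ 8 ∣ 9 * x.1.natAbs := by simpa using pw2 h3g
    have h' : 3 ^ 6 ∣ x.1.natAbs := Nat.dvd_of_mul_dvd_mul_left (k := 9) (by norm_num) (by convert h using 1; ring)
    exact_mod_cast Int.ofNat_dvd_left.mpr ((pow_dvd_pow 3 (by norm_num : 5 ≤ 6)).trans h')
  · have h : 3 ^ 12 ∣ 54 * x.2.natAbs := by simpa using pw3 h3g
    have h' : 3 ^ 9 ∣ 2 * x.2.natAbs := Nat.dvd_of_mul_dvd_mul_left (k := 27) (by norm_num) (by convert h using 1 <;> ring)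
    exact_mod_cast Int.ofNat_dvd_left.mpr ((by decide : Nat.Coprime (3 ^ 9) 2).dvd_of_dvd_mul_left h')

/-- The image of a cusp pair lies in the index-form shell at level `186624·Y`: `Mplus F q = 186624·Mcusp x`
(`186624 = 108·1728 = 256·9³`), `N5 F q = N5cusp x` (`p ≥ 5`: `p ∣ D·F(q) ⟺ p ∣ Δ`, `p ∣ 9c₄ ⟺ p ∣ c₄`), `ContentOK`. -/
theorem mem_ifShell_of_data {X Y : ℝ} {x : ℤ × ℤ} (hx : x ∈ cuspShell X Y) {F : BinaryCubic ℤ} {q : ℤ × ℤ}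
    (hH : hessAt F q.1 q.2 = 9 * x.1) (hG : covAt F q.1 q.2 = -54 * x.2)
    (hDF : F.disc * F.eval q.1 q.2 ^ 2 = 108 * (x.1 ^ 3 - x.2 ^ 2)) : q ∈ ifShell F X (186624 * Y) := by
  obtain ⟨h1, h2, h3, ⟨Δ, hΔ⟩, hTF, hYle, hYlt, hN⟩ := hx
  have hΔ0 : Δ ≠ 0 := by rintro rfl; exact h3 (sub_eq_zero.mp (by simpa using hΔ))
  have hdiv : (x.1 ^ 3 - x.2 ^ 2) / 1728 = Δ := by rw [hΔ]; exact Int.mul_ediv_cancel_left _ (by norm_num)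
  have e1 : (F.disc * F.eval q.1 q.2 ^ 2).natAbs = 186624 * Δ.natAbs := by
    rw [hDF, hΔ, show (108 : ℤ) * (1728 * Δ) = 186624 * Δ by ring, Int.natAbs_mul]; rfl
  have hDf : F.disc * F.eval q.1 q.2 ^ 2 ≠ 0 := by rw [hDF]; exact mul_ne_zero (by norm_num) (sub_ne_zero.mpr h3)
  have hD : F.disc.natAbs ≠ 0 := Int.natAbs_ne_zero.mpr (left_ne_zero_of_mul hDf)
  have hf0 : F.eval q.1 q.2 ≠ 0 := fun h => (right_ne_zero_of_mul hDf) (by rw [h]; ring)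
  have hf : (F.eval q.1 q.2).natAbs ≠ 0 := Int.natAbs_ne_zero.mpr hf0
  have hM : Mplus F q = 186624 * Mcusp x := by
    have e2 : 256 * (hessAt F q.1 q.2).natAbs ^ 3 = 186624 * x.1.natAbs ^ 3 := by rw [hH, Int.natAbs_mul]; simp; ring
    unfold Mplus Mcusp
    rw [e1, e2, hdiv]
    rcases le_total Δ.natAbs (x.1.natAbs ^ 3) with h | h
    · rw [max_eq_right h, max_eq_right (Nat.mul_le_mul_left 186624 h)]
    · rw [max_eq_left h, max_eq_left (Nat.mul_le_mul_left 186624 h)]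
  have hN5 : N5 F q = N5cusp x := by
    have e0 : (F.disc * F.eval q.1 q.2).natAbs.primeFactors = (F.disc * F.eval q.1 q.2 ^ 2).natAbs.primeFactors := by
      rw [Int.natAbs_mul, Int.natAbs_mul, Int.natAbs_pow, Nat.primeFactors_mul hD hf,
        Nat.primeFactors_mul hD (pow_ne_zero 2 hf), Nat.primeFactors_pow _ two_ne_zero]
    have hset : (186624 * Δ.natAbs).primeFactors.filter (5 ≤ ·) = Δ.natAbs.primeFactors.filter (5 ≤ ·) := by
      ext p
      simp only [Finset.mem_filter, Nat.mem_primeFactors]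
      constructor
      · rintro ⟨⟨hp, hdvd, -⟩, h5⟩
        refine ⟨⟨hp, ?_, Int.natAbs_ne_zero.mpr hΔ0⟩, h5⟩
        rcases (Nat.Prime.dvd_mul hp).mp hdvd with h | h
        · rcases (Nat.Prime.dvd_mul hp).mp (show p ∣ 2 ^ 8 * 3 ^ 6 by norm_num; exact h) with h2 | h3
          · have := (Nat.prime_dvd_prime_iff_eq hp Nat.prime_two).mp (hp.dvd_of_dvd_pow h2); omega
          · have := (Nat.prime_dvd_prime_iff_eq hp Nat.prime_three).mp (hp.dvd_of_dvd_pow h3); omega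
        · exact h
      · rintro ⟨⟨hp, hdvd, hne⟩, h5⟩
        exact ⟨⟨hp, dvd_mul_of_dvd_right hdvd _, mul_ne_zero (by norm_num) hne⟩, h5⟩
    unfold N5 N5cusp
    rw [e0, e1, hdiv, hH, hset]
    refine Finset.prod_congr rfl fun p hp => ?_
    obtain ⟨hp, h5⟩ := Finset.mem_filter.mp hp
    have hp : p.Prime := (Nat.mem_primeFactors.mp hp).1
    refine if_congr ⟨fun h => ?_, fun h => dvd_mul_of_dvd_right h 9⟩ rfl rfl
    rcases (Nat.prime_iff_prime_int.mp hp).dvd_or_dvd h with h9 | h1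
    · have h9' : p ∣ 9 := by exact_mod_cast h9
      have := (Nat.prime_dvd_prime_iff_eq hp Nat.prime_three).mp (hp.dvd_of_dvd_pow (n := 2) (by norm_num; exact h9'))
      omega
    · exact h1
  refine ⟨hf0, ?_, ?_, contentOK_of_data hTF hH hG, ?_, ?_, ?_⟩
  · rw [hH]; exact mul_ne_zero (by norm_num) h1
  · rw [hG]; exact mul_ne_zero (by norm_num) h2
  · rw [hM]; push_cast; linarith
  · rw [hM]; push_cast; linarith
  · rw [hN5]; exact hN

/-- The counted shell set of an orbit representative is finite (for `D ≠ 0`). -/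
private theorem shellSet_finite {D : ℤ} (hD : D ≠ 0) (O : orbitsOfDisc D) (X Y : ℝ) :
    {q : ℤ × ℤ | RingOfForm.IsMaximal (orbitRep O) ∧ q ∈ ifShell (orbitRep O) X Y ∧ True}.Finite := by
  refine (finite_mplus_le (orbitRep O) (by rw [(orbitRep_spec O).2]; exact hD) ⌈2 * Y⌉₊).subset ?_
  rintro q ⟨-, hq, -⟩
  exact_mod_cast (show (Mplus (orbitRep O) q : ℝ) ≤ ⌈2 * Y⌉₊ from (le_of_lt hq.2.2.2.2.2.1).trans (Nat.le_ceil _))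

/-- **The injection** `x ↦ (D, O, q)`: `#cuspShell X Y ≤ totalCount ⊤ X (186624·Y)`. -/
theorem ncard_cuspShell_le (X Y : ℝ) : (cuspShell X Y).ncard ≤ totalCount (fun _ _ _ _ => True) X (186624 * Y) := by
  classical
  set Y' : ℝ := 186624 * Y with hY'
  choose D O q hspec using exists_indexFormData
  -- `Finset` models of the orbits of discriminant `D ≠ 0` and of the counted shell sets
  obtain ⟨orbFin, horb⟩ : ∃ f : (D : ℤ) → Finset (orbitsOfDisc D), ∀ D, D ≠ 0 → ∀ O, O ∈ f D :=
    ⟨fun D => if hD : D = 0 then ∅ else (@Set.finite_univ (orbitsOfDisc D) (finite_orbitsOfDisc hD)).toFinset,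
      fun D hD O => by simp only [dif_neg hD, Set.Finite.mem_toFinset, Set.mem_univ]⟩
  obtain ⟨shellFin, hcard, hmemS⟩ : ∃ g : (D : ℤ) → orbitsOfDisc D → Finset (ℤ × ℤ),
      (∀ D, D ≠ 0 → ∀ O, shellCount (fun _ _ _ _ => True) X Y' (orbitRep O) = (g D O).card) ∧
      (∀ D (hD : D ≠ 0) O q, RingOfForm.IsMaximal (orbitRep O) → q ∈ ifShell (orbitRep O) X Y' → q ∈ g D O) :=
    ⟨fun D O => if hD : D = 0 then ∅ else (shellSet_finite hD O X Y').toFinset,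
      fun D hD O => by simp only [dif_neg hD]; exact Set.ncard_eq_toFinset_card _ (shellSet_finite hD O X Y'),
      fun D hD O q h1 h2 => by simp only [dif_neg hD, Set.Finite.mem_toFinset]; exact ⟨h1, h2, trivial⟩⟩
  let U : Finset (Σ D : ℤ, Σ _ : orbitsOfDisc D, ℤ × ℤ) :=
    ((Finset.Icc (-(⌈2 * Y'⌉₊ : ℤ)) (⌈2 * Y'⌉₊ : ℤ)).erase 0).sigma fun D => (orbFin D).sigma fun O => shellFin D O
  have hU : U.card = totalCount (fun _ _ _ _ => True) X Y' := by
    rw [Finset.card_sigma]; unfold totalCount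
    refine Finset.sum_congr rfl fun D hD => ?_
    have hD0 : D ≠ 0 := (Finset.mem_erase.mp hD).1
    rw [Finset.card_sigma]; unfold orbitTotal
    rw [finsum_eq_finsetSum_of_support_subset _ (fun O _ => Finset.mem_coe.mpr (horb D hD0 O))]
    exact Finset.sum_congr rfl fun O _ => (hcard D hD0 O).symm
  let Φ : ℤ × ℤ → (Σ D : ℤ, Σ _ : orbitsOfDisc D, ℤ × ℤ) := fun x => ⟨D x, O x, q x⟩
  have hmem : ∀ x ∈ cuspShell X Y, Φ x ∈ (U : Set _) := by
    intro x hx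
    obtain ⟨hmax, hH, hG, hDF⟩ := hspec x hx.2.2.1
    have hdisc : (orbitRep (O x)).disc = D x := (orbitRep_spec (O x)).2
    have hq : q x ∈ ifShell (orbitRep (O x)) X Y' := mem_ifShell_of_data hx hH hG hDF
    have hD0 : D x ≠ 0 := by
      rw [← hdisc]; refine left_ne_zero_of_mul (b := (orbitRep (O x)).eval (q x).1 (q x).2 ^ 2) ?_
      rw [hDF]; exact mul_ne_zero (by norm_num) (sub_ne_zero.mpr hx.2.2.1)
    have hDle : (D x).natAbs ≤ ⌈2 * Y'⌉₊ := by
      have hlt : (Mplus (orbitRep (O x)) (q x) : ℝ) < 2 * Y' := hq.2.2.2.2.2.1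
      have hM : Mplus (orbitRep (O x)) (q x) ≤ ⌈2 * Y'⌉₊ := by exact_mod_cast hlt.le.trans (Nat.le_ceil _)
      refine le_trans ?_ ((le_max_left _ _).trans hM)
      rw [show (D x).natAbs = (orbitRep (O x)).disc.natAbs by rw [hdisc], Int.natAbs_mul, Int.natAbs_pow]
      exact Nat.le_mul_of_pos_right _ (pow_pos (Int.natAbs_pos.mpr hq.1) 2)
    refine Finset.mem_coe.mpr (Finset.mem_sigma.mpr ⟨?_, Finset.mem_sigma.mpr ⟨horb _ hD0 _, hmemS _ hD0 _ _ hmax hq⟩⟩)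
    refine Finset.mem_erase.mpr ⟨hD0, Finset.mem_Icc.mpr (abs_le.mp ?_)⟩
    rw [← Int.natCast_natAbs]; exact_mod_cast hDle
  have hinj : Set.InjOn Φ (cuspShell X Y) := by
    intro x₁ hx₁ x₂ hx₂ h
    obtain ⟨-, hH₁, hG₁, -⟩ := hspec x₁ hx₁.2.2.1
    obtain ⟨-, hH₂, hG₂, -⟩ := hspec x₂ hx₂.2.2.1
    have h' : (orbitRep (O x₁), q x₁) = (orbitRep (O x₂), q x₂) :=
      congrArg (fun s : (Σ D : ℤ, Σ _ : orbitsOfDisc D, ℤ × ℤ) => (orbitRep s.2.1, s.2.2)) h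
    obtain ⟨hF, hq⟩ := Prod.mk.inj h'
    rw [hF, hq] at hH₁ hG₁
    exact Prod.ext (by linarith) (by linarith)
  calc (cuspShell X Y).ncard ≤ (U : Set _).ncard := Set.ncard_le_ncard_of_injOn Φ hmem hinj (Finset.finite_toSet U)
    _ = U.card := Set.ncard_coe_finset U
    _ = totalCount (fun _ _ _ _ => True) X Y' := hU

/-- **stub_syzygyTransfer** (registered stub of stmt-ABC-1975): the index-form shell law implies the cusp shell
law, with constant `max C 0 · 186624^ε` (`#cuspShell X Y ≤ totalCount ⊤ X (186624Y)`, `(186624Y)^{-1/6} ≤ Y^{-1/6}`). -/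
theorem stub_syzygyTransfer : SyzygyTransfer := by
  intro hIF ε hε
  obtain ⟨C, hC⟩ := hIF ε hε
  refine ⟨max C 0 * (186624 : ℝ) ^ ε, fun X Y hX hY => ?_⟩
  have hX0 : 0 < X := by linarith
  have hY0 : 0 < Y := by linarith
  have h1 := hC X (186624 * Y) hX (by linarith)
  have e1 : (X * (186624 * Y)) ^ ε = (186624 : ℝ) ^ ε * (X * Y) ^ ε := by
    rw [show X * (186624 * Y) = 186624 * (X * Y) by ring]; exact Real.mul_rpow (by norm_num) (by positivity)
  have e2 : (186624 * Y) ^ (-(1 / 6 : ℝ)) ≤ Y ^ (-(1 / 6 : ℝ)) := by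
    rw [Real.mul_rpow (by norm_num) hY0.le]
    have h6 : (186624 : ℝ) ^ (-(1 / 6 : ℝ)) ≤ 1 := Real.rpow_le_one_of_one_le_of_nonpos (by norm_num) (by norm_num)
    have h0 : 0 ≤ Y ^ (-(1 / 6 : ℝ)) := Real.rpow_nonneg hY0.le _
    nlinarith
  have hE : 0 ≤ (X * (186624 * Y)) ^ ε := Real.rpow_nonneg (by positivity) ε
  have hA : 0 ≤ X * (186624 * Y) ^ (-(1 / 6 : ℝ)) + 1 := by positivity
  have hA' : X * (186624 * Y) ^ (-(1 / 6 : ℝ)) + 1 ≤ X * Y ^ (-(1 / 6 : ℝ)) + 1 := by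
    nlinarith [mul_le_mul_of_nonneg_left e2 hX0.le]
  calc ((cuspShell X Y).ncard : ℝ)
      ≤ (totalCount (fun _ _ _ _ => True) X (186624 * Y) : ℝ) := by exact_mod_cast ncard_cuspShell_le X Y
    _ ≤ C * (X * (186624 * Y)) ^ ε * (X * (186624 * Y) ^ (-(1 / 6 : ℝ)) + 1) := h1
    _ ≤ max C 0 * (X * (186624 * Y)) ^ ε * (X * Y ^ (-(1 / 6 : ℝ)) + 1) :=
        mul_le_mul (mul_le_mul_of_nonneg_right (le_max_left _ _) hE) hA' hA (mul_nonneg (le_max_right _ _) hE)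
    _ = max C 0 * (186624 : ℝ) ^ ε * (X * Y) ^ ε * (X * Y ^ (-(1 / 6 : ℝ)) + 1) := by rw [e1]; ring

end Summit.ABC.ABC.Theorems.SharpModerateLaw

end
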